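import Literature.Algebra.EuclideanLattices.DiscreteGaussianInt
import Mathlib.Analysis.Complex.Exponential
import Mathlib.Analysis.SpecialFunctions.Pow.Real
import Mathlib.Probability.Distributions.Uniform
import Literature.Computability.Cryptography.StatisticalDistanceProofs
import HarnessLib

/-!
# A coin-driven rejection sampler for the discrete Gaussian `D_{ℤ,s,c}` with rational data, and its law

Topic `Probability/Distributions`, sequel of `Literature/Algebra/EuclideanLattices/DiscreteGaussianInt.lean`
(`discreteGaussianInt s c = D_{ℤ,s,c}`, `D(k) ∝ ρ_s(k - c) = e^{-π(k-c)²/s²}`). The one-dimensional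
primitive of the GPV sampler (Gentry–Peikert–Vaikuntanathan 2008, §4.1 "SampleZ": *"choose `x` uniformly
at random from `ℤ ∩ [c - s·t(n), c + s·t(n)]`, then with probability `ρ_s(x - c)` output `x`, otherwise
repeat"*) for a machine that has only coins and exact rational arithmetic: the weight is written
`e^{-θ(x-c)²}` with RATIONAL `θ = π/s²` and `c` (the consumer arranges `s² ∈ π·ℚ`), the exponential is
replaced by an exactly computable rational (`expNegApprox`: Taylor polynomial at `-y/2ˢ`, clamped to
`[0,1]`, then `s` squarings), the acceptance coin is a `P`-bit uniform compared with `⌊2ᴾ·weight⌋`, the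
proposal is uniform on the dyadic window `round(c) + [-2ʷ, 2ʷ)`, and the number of rounds is a fixed `R`
(output `round c` if none accepts). Everything here is PROVED; the definitions have bodies; no named fact.

* `taylorExpNeg`, `clamp01`, `expNegApprox y s N` and **`abs_exp_neg_sub_expNegApprox_le`**:
  `|e^{-y} - expNegApprox y s N| ≤ 2^{s+1}/N!` for `0 ≤ y ≤ 2ˢ`, `1 ≤ N` (`Real.exp_bound` on `[-1,0]`,
  clamping is a contraction towards `e^{-y/2ˢ} ∈ [0,1]`, and `|aᴷ - bᴷ| ≤ K|a - b|` on `[0,1]`);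
  `expNegApprox_nonneg`, `expNegApprox_le_one`.
* `accNum θ c s N P x = ⌊2ᴾ · expNegApprox (θ(x-c)²) s N⌋₊ ≤ 2ᴾ` (`abs_accNum_div_sub_exp_le`),
  `window c w o = round c + (o - 2ʷ)` (`window_injective`, `mem_range_window_iff`, `abs_window_sub_le`),
  `accept`, **`rejLaw θ c s N P w R`** (`R` rounds, default `round c`) — the law the machine of the sequel
  realises on uniform coins —, `accTot`, `accOn`, `accProb = accTot/(2^{w+1}2ᴾ)`.
* The analysis: `rejLaw_succ_apply` / `rejLaw_succ_toReal` / **`rejLaw_toReal`** (the closed form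
  `E_R(x) = accOn(x)/card·∑_{r<R}(1-A)ʳ + (1-A)ᴿ·[x = round c]`); the Gaussian side `gfun`, `Zr`, `GW`,
  `hasSum_gfun`, `discreteGaussianInt_toReal` (`D(x) = e^{-θ(x-c)²}/Z`), `GW_le_Zr`; the generic
  normalisation lemma `sum_abs_div_sub_div_le`; **`tvDist_rejLaw_discreteGaussianInt_le`**:
  `Δ(rejLaw R, D_{ℤ,√(π/θ),c}) ≤ (1-A)ᴿ + 2^{w+1}η/G_W + (Z - G_W)/Z` whenever the acceptance
  probabilities on the window are `η`-accurate; the hypotheses from the parameters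
  (`abs_accNum_window_sub_le`, `accTot_pos`, `accProb_ge`, `GW_ge`, the tail `Zr_sub_GW_le`), assembled in
  **`tvDist_rejLaw_le_of_params`**.

## References

* C. Gentry, C. Peikert, V. Vaikuntanathan, *Trapdoors for hard lattices and new cryptographic
  constructions*, STOC 2008, §4.1 (SampleZ by rejection from the uniform distribution on
  `ℤ ∩ [c - s·t, c + s·t]`; Lemma 4.2: its output is statistically close to `D_{ℤ,s,c}` and it
  terminates in expected `O(t)` rounds) [GentryPeikertVaikuntanathan2008].
* J. von Neumann, *Various techniques used in connection with random digits*, NBS Appl. Math. Ser. 12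
  (1951) 36–38 (rejection sampling; not keyed in references.bib).
-/

noncomputable section

open Finset Real
open scoped ENNReal

namespace Literature.Probability.Distributions

namespace GaussRej

/-! ### A rational approximation of `e^{-y}` -/

/-- The Taylor polynomial `∑_{i<N} (-z)ⁱ/i!` of `e^{-z}`, an exact rational for rational `z`. [folklore] -/
def taylorExpNeg (z : ℚ) (N : ℕ) : ℚ := ∑ i ∈ range N, (-z) ^ i / (i.factorial : ℚ)

/-- Clamping to `[0, 1]`. [folklore] -/
def clamp01 (t : ℚ) : ℚ := max 0 (min 1 t)

/-- **The rational stand-in for `e^{-y}`**: `(clamp₀¹ T_N(-y/2ˢ))^{2ˢ}` — Taylor at the reduced argument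
`y/2ˢ ∈ [0,1]`, clamped, then `s` squarings. [folklore] -/
def expNegApprox (y : ℚ) (s N : ℕ) : ℚ := clamp01 (taylorExpNeg (y / 2 ^ s) N) ^ 2 ^ s

/-- `0 ≤ clamp₀¹ t ≤ 1`. [folklore] -/
theorem clamp01_mem (t : ℚ) : 0 ≤ clamp01 t ∧ clamp01 t ≤ 1 :=
  ⟨le_max_left _ _, max_le zero_le_one (min_le_left _ _)⟩

/-- Clamping to an interval containing `a` does not move away from `a`: `|a - clamp t| ≤ |a - t|` for
`a ∈ [0,1]`. [folklore] -/
theorem abs_sub_clamp01_le {a : ℝ} (ha0 : 0 ≤ a) (ha1 : a ≤ 1) (t : ℚ) :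
    |a - (clamp01 t : ℝ)| ≤ |a - (t : ℝ)| := by
  unfold clamp01
  push_cast
  rcases le_total (t : ℝ) 0 with ht | ht
  · rw [min_eq_right (ht.trans zero_le_one), max_eq_left ht]
    rw [abs_of_nonneg (by linarith), abs_of_nonneg (by linarith)]
    linarith
  · rcases le_total (t : ℝ) 1 with ht1 | ht1
    · rw [min_eq_right ht1, max_eq_right ht]
    · rw [min_eq_left ht1, max_eq_right zero_le_one]
      rw [abs_of_nonpos (by linarith), abs_of_nonpos (by linarith)]
      linarith

/-- `|aᴷ - bᴷ| ≤ K·|a - b|` for `a, b ∈ [0, 1]`. [folklore] -/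
theorem abs_pow_sub_pow_le {a b : ℝ} (ha0 : 0 ≤ a) (ha1 : a ≤ 1) (hb0 : 0 ≤ b) (hb1 : b ≤ 1) :
    ∀ K : ℕ, |a ^ K - b ^ K| ≤ K * |a - b|
  | 0 => by simp
  | K + 1 => by
    have ih := abs_pow_sub_pow_le ha0 ha1 hb0 hb1 K
    have hsplit : a ^ (K + 1) - b ^ (K + 1) = a ^ K * (a - b) + (a ^ K - b ^ K) * b := by ring
    rw [hsplit]
    refine (abs_add_le _ _).trans ?_
    rw [abs_mul, abs_mul, abs_of_nonneg (pow_nonneg ha0 K), abs_of_nonneg hb0]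
    have h1 : a ^ K * |a - b| ≤ 1 * |a - b| :=
      mul_le_mul_of_nonneg_right (pow_le_one₀ ha0 ha1) (abs_nonneg _)
    have h2 : |a ^ K - b ^ K| * b ≤ K * |a - b| * 1 :=
      mul_le_mul ih hb1 hb0 (by positivity)
    push_cast
    linarith

/-- `0 ≤ expNegApprox`. [folklore] -/
theorem expNegApprox_nonneg (y : ℚ) (s N : ℕ) : 0 ≤ expNegApprox y s N :=
  pow_nonneg (clamp01_mem _).1 _

/-- `expNegApprox ≤ 1`. [folklore] -/
theorem expNegApprox_le_one (y : ℚ) (s N : ℕ) : expNegApprox y s N ≤ 1 :=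
  pow_le_one₀ (clamp01_mem _).1 (clamp01_mem _).2

/-- **`|e^{-y} - expNegApprox y s N| ≤ 2^{s+1}/N!`** for `0 ≤ y ≤ 2ˢ` and `1 ≤ N`: the Taylor remainder at
the reduced argument is `≤ (N+1)/(N!·N) ≤ 2/N!` (`Real.exp_bound`), clamping does not increase the error,
and the `2ˢ`-th power of numbers in `[0,1]` is `2ˢ`-Lipschitz (`e^{-y} = (e^{-y/2ˢ})^{2ˢ}`). [folklore] -/
theorem abs_exp_neg_sub_expNegApprox_le {y : ℚ} (hy0 : 0 ≤ y) {s : ℕ} (hys : (y : ℝ) ≤ 2 ^ s) {N : ℕ}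
    (hN : 1 ≤ N) :
    |Real.exp (-(y : ℝ)) - (expNegApprox y s N : ℝ)| ≤ 2 ^ (s + 1) / N.factorial := by
  set z : ℝ := (y : ℝ) / 2 ^ s with hz
  have h2s : (0 : ℝ) < 2 ^ s := by positivity
  have hz0 : 0 ≤ z := div_nonneg (by exact_mod_cast hy0) h2s.le
  have hz1 : z ≤ 1 := by rw [hz, div_le_one h2s]; exact hys
  -- Taylor at `-z`
  have htaylor : |Real.exp (-z) - (taylorExpNeg (y / 2 ^ s) N : ℝ)| ≤ 2 / N.factorial := by
    have hcast : (taylorExpNeg (y / 2 ^ s) N : ℝ) = ∑ m ∈ range N, (-z) ^ m / m.factorial := by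
      unfold taylorExpNeg; push_cast; rw [hz]
    rw [hcast]
    have h := Real.exp_bound (x := -z) (by rw [abs_neg, abs_of_nonneg hz0]; exact hz1) hN
    refine h.trans ?_
    rw [abs_neg, abs_of_nonneg hz0]
    have hfac : (0 : ℝ) < N.factorial := by exact_mod_cast N.factorial_pos
    have hNpos : (0 : ℝ) < N := by exact_mod_cast hN
    have h1 : z ^ N ≤ 1 := pow_le_one₀ hz0 hz1
    have h2 : ((N.succ : ℕ) : ℝ) / (N.factorial * N) ≤ 2 / N.factorial := by
      rw [div_le_div_iff₀ (by positivity) hfac]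
      push_cast
      have hN' : (1 : ℝ) ≤ N := by exact_mod_cast hN
      have hN1 : (N : ℝ) + 1 ≤ 2 * N := by linarith
      have := mul_le_mul_of_nonneg_right hN1 hfac.le
      nlinarith
    calc z ^ N * ((N.succ : ℕ) / (N.factorial * N)) ≤ 1 * (2 / N.factorial) :=
          mul_le_mul h1 h2 (by positivity) zero_le_one
      _ = 2 / N.factorial := one_mul _
  -- clamp
  have hexp0 : 0 ≤ Real.exp (-z) := (Real.exp_pos _).le
  have hexp1 : Real.exp (-z) ≤ 1 := by rw [Real.exp_le_one_iff]; linarith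
  have hclamp : |Real.exp (-z) - (clamp01 (taylorExpNeg (y / 2 ^ s) N) : ℝ)| ≤ 2 / N.factorial :=
    (abs_sub_clamp01_le hexp0 hexp1 _).trans htaylor
  -- power
  obtain ⟨hc0, hc1⟩ := clamp01_mem (taylorExpNeg (y / 2 ^ s) N)
  have hc0' : (0 : ℝ) ≤ (clamp01 (taylorExpNeg (y / 2 ^ s) N) : ℝ) := by exact_mod_cast hc0
  have hc1' : ((clamp01 (taylorExpNeg (y / 2 ^ s) N) : ℚ) : ℝ) ≤ 1 := by exact_mod_cast hc1
  have hpow := abs_pow_sub_pow_le hexp0 hexp1 hc0' hc1' (2 ^ s)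
  have hexpy : Real.exp (-z) ^ 2 ^ s = Real.exp (-(y : ℝ)) := by
    rw [← Real.exp_nat_mul]
    congr 1
    rw [hz]; push_cast; field_simp
  rw [hexpy] at hpow
  unfold expNegApprox
  push_cast
  refine hpow.trans ?_
  calc ((2 ^ s : ℕ) : ℝ) * |Real.exp (-z) - (clamp01 (taylorExpNeg (y / 2 ^ s) N) : ℝ)| ≤ (2 : ℝ) ^ s * (2 / N.factorial) := by
        push_cast; exact mul_le_mul_of_nonneg_left hclamp (by positivity)
    _ = 2 ^ (s + 1) / N.factorial := by rw [pow_succ]; ring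

/-! ### The sampler: acceptance numerators, the window, the law of `R` rounds -/

section Sampler

variable (θ c : ℚ) (s N P w : ℕ)

/-- **The acceptance numerator** of the point `x`: `⌊2ᴾ · expNegApprox(θ(x-c)²)⌋`; the round accepts `x`
iff its `P`-bit coin is `< accNum x`. [cite: GentryPeikertVaikuntanathan2008, §4.1 ("with probability `ρ_s(x - c)`")] -/
def accNum (x : ℤ) : ℕ := ⌊(2 : ℚ) ^ P * expNegApprox (θ * ((x : ℚ) - c) ^ 2) s N⌋₊

/-- `accNum x ≤ 2ᴾ`. [folklore] -/
theorem accNum_le (x : ℤ) : accNum θ c s N P x ≤ 2 ^ P := by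
  unfold accNum
  refine Nat.floor_le_of_le ?_
  have h := expNegApprox_le_one (θ * ((x : ℚ) - c) ^ 2) s N
  have : (2 : ℚ) ^ P * expNegApprox (θ * ((x : ℚ) - c) ^ 2) s N ≤ 2 ^ P * 1 :=
    mul_le_mul_of_nonneg_left h (by positivity)
  push_cast
  linarith

/-- **Accuracy of the acceptance probability**: `|accNum(x)/2ᴾ - e^{-θ(x-c)²}| ≤ 2^{s+1}/N! + 2⁻ᴾ` when
`0 ≤ θ`, `θ(x-c)² ≤ 2ˢ`, `N ≥ 1`. [folklore] -/
theorem abs_accNum_div_sub_exp_le {θ c : ℚ} (hθ : 0 ≤ θ) {s N : ℕ} (P : ℕ) (x : ℤ)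
    (hy : ((θ * ((x : ℚ) - c) ^ 2 : ℚ) : ℝ) ≤ 2 ^ s) (hN : 1 ≤ N) :
    |(accNum θ c s N P x : ℝ) / 2 ^ P - Real.exp (-(θ * ((x : ℝ) - c) ^ 2))| ≤
      2 ^ (s + 1) / N.factorial + 1 / 2 ^ P := by
  set y : ℚ := θ * ((x : ℚ) - c) ^ 2 with hydef
  have hy0 : 0 ≤ y := by rw [hydef]; positivity
  set E : ℚ := expNegApprox y s N with hE
  have hE0 : 0 ≤ E := expNegApprox_nonneg _ _ _
  have h2P : (0 : ℝ) < 2 ^ P := by positivity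
  -- the floor
  have hfl1 : ((accNum θ c s N P x : ℕ) : ℝ) ≤ 2 ^ P * (E : ℝ) := by
    have h := Nat.floor_le (a := (2 : ℚ) ^ P * E) (by positivity)
    have h' : ((⌊(2 : ℚ) ^ P * E⌋₊ : ℕ) : ℝ) ≤ (((2 : ℚ) ^ P * E : ℚ) : ℝ) := by exact_mod_cast h
    simpa [accNum, hE, hydef] using h'
  have hfl2 : 2 ^ P * (E : ℝ) - 1 ≤ ((accNum θ c s N P x : ℕ) : ℝ) := by
    have h := (Nat.lt_floor_add_one ((2 : ℚ) ^ P * E)).le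
    have h' : (((2 : ℚ) ^ P * E : ℚ) : ℝ) ≤ ((⌊(2 : ℚ) ^ P * E⌋₊ : ℕ) : ℝ) + 1 := by exact_mod_cast h
    have h'' : (((2 : ℚ) ^ P * E : ℚ) : ℝ) = 2 ^ P * (E : ℝ) := by push_cast; ring
    rw [h''] at h'
    simpa [accNum, hE, hydef] using (by linarith : 2 ^ P * (E : ℝ) - 1 ≤ ((⌊(2 : ℚ) ^ P * E⌋₊ : ℕ) : ℝ))
  have hfloor : |((accNum θ c s N P x : ℕ) : ℝ) / 2 ^ P - (E : ℝ)| ≤ 1 / 2 ^ P := by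
    rw [abs_le]
    constructor
    · have h1 : (E : ℝ) - 1 / 2 ^ P ≤ ((accNum θ c s N P x : ℕ) : ℝ) / 2 ^ P := by
        rw [le_div_iff₀ h2P, sub_mul, div_mul_cancel₀ _ h2P.ne']
        linarith
      linarith
    · have h1 : ((accNum θ c s N P x : ℕ) : ℝ) / 2 ^ P ≤ (E : ℝ) := by
        rw [div_le_iff₀ h2P]; linarith
      have h2 : (0 : ℝ) ≤ 1 / 2 ^ P := by positivity
      linarith
  have happrox := abs_exp_neg_sub_expNegApprox_le hy0 hy hN
  have hcast : ((y : ℚ) : ℝ) = θ * ((x : ℝ) - c) ^ 2 := by rw [hydef]; push_cast; ring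
  rw [hcast] at happrox
  calc |((accNum θ c s N P x : ℕ) : ℝ) / 2 ^ P - Real.exp (-(θ * ((x : ℝ) - c) ^ 2))|
      ≤ |((accNum θ c s N P x : ℕ) : ℝ) / 2 ^ P - (E : ℝ)| + |(E : ℝ) - Real.exp (-(θ * ((x : ℝ) - c) ^ 2))| :=
        abs_sub_le _ _ _
    _ ≤ 1 / 2 ^ P + 2 ^ (s + 1) / N.factorial := add_le_add hfloor (by rw [abs_sub_comm]; exact happrox)
    _ = _ := add_comm _ _

/-- **The proposal window**: `round(c) + (o - 2ʷ)` for `o < 2^{w+1}`, i.e. the `2^{w+1}` integers of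
`round(c) + [-2ʷ, 2ʷ)` (uniform from `w + 1` coin bits). [cite: GentryPeikertVaikuntanathan2008, §4.1 ("uniformly at random from `ℤ ∩ [c - s·t, c + s·t]`")] -/
def window (o : Fin (2 ^ (w + 1))) : ℤ := round c + ((o : ℕ) : ℤ) - 2 ^ w

/-- The window map is injective. [folklore] -/
theorem window_injective : Function.Injective (window c w) := by
  intro o o' h
  unfold window at h
  exact Fin.ext (by exact_mod_cast (by linarith : ((o : ℕ) : ℤ) = (o' : ℕ)))

/-- `x` is in the window iff `-2ʷ ≤ x - round c < 2ʷ`. [folklore] -/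
theorem mem_range_window_iff (x : ℤ) :
    x ∈ Set.range (window c w) ↔ -(2 : ℤ) ^ w ≤ x - round c ∧ x - round c < 2 ^ w := by
  constructor
  · rintro ⟨o, rfl⟩
    unfold window
    have ho := o.isLt
    have h2 : ((2 ^ (w + 1) : ℕ) : ℤ) = 2 * 2 ^ w := by push_cast; ring
    have ho' : ((o : ℕ) : ℤ) < ((2 ^ (w + 1) : ℕ) : ℤ) := by exact_mod_cast ho
    rw [h2] at ho'
    have h0 : (0 : ℤ) ≤ ((o : ℕ) : ℤ) := by positivity
    constructor <;> linarith
  · rintro ⟨h1, h2⟩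
    have hK : ((2 ^ (w + 1) : ℕ) : ℤ) = 2 * (2 : ℤ) ^ w := by push_cast; ring
    have hlt : x - round c + 2 ^ w < ((2 ^ (w + 1) : ℕ) : ℤ) := by rw [hK]; linarith
    have hnn : 0 ≤ x - round c + 2 ^ w := by linarith
    refine ⟨⟨(x - round c + 2 ^ w).toNat, ?_⟩, ?_⟩
    · have := (Int.toNat_lt hnn).2 hlt
      exact_mod_cast this
    · unfold window
      push_cast
      rw [Int.toNat_of_nonneg hnn]
      ring

/-- Points of the window are within `2ʷ + 1/2` of the centre: `|x - c| ≤ |x - round c| + 1/2`. [folklore] -/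
theorem abs_window_sub_le (o : Fin (2 ^ (w + 1))) : |((window c w o : ℤ) : ℝ) - (c : ℝ)| ≤ 2 ^ w + 1 / 2 := by
  have hrc : |((round c : ℤ) : ℝ) - (c : ℝ)| ≤ 1 / 2 := by
    have h := abs_sub_round (c : ℝ)
    rw [abs_sub_comm] at h
    have : ((round c : ℤ) : ℝ) = ((round (c : ℝ) : ℤ) : ℝ) := by rw [Rat.round_cast]
    rw [this]; exact h
  have hin := (mem_range_window_iff c w (window c w o)).1 ⟨o, rfl⟩
  have h1 : |((window c w o : ℤ) : ℝ) - ((round c : ℤ) : ℝ)| ≤ 2 ^ w := by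
    rw [abs_le]
    obtain ⟨ha, hb⟩ := hin
    constructor
    · have : ((-(2 : ℤ) ^ w : ℤ) : ℝ) ≤ ((window c w o - round c : ℤ) : ℝ) := by exact_mod_cast ha
      push_cast at this; linarith
    · have : ((window c w o - round c : ℤ) : ℝ) ≤ (((2 : ℤ) ^ w : ℤ) : ℝ) := by exact_mod_cast hb.le
      push_cast at this; linarith
  calc |((window c w o : ℤ) : ℝ) - (c : ℝ)|
      = |(((window c w o : ℤ) : ℝ) - ((round c : ℤ) : ℝ)) + (((round c : ℤ) : ℝ) - (c : ℝ))| := by ring_nf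
    _ ≤ |((window c w o : ℤ) : ℝ) - ((round c : ℤ) : ℝ)| + |((round c : ℤ) : ℝ) - (c : ℝ)| := abs_add_le _ _
    _ ≤ 2 ^ w + 1 / 2 := add_le_add h1 hrc

/-- **One round accepts** the coin pair `(o, u)` iff `u < accNum(window o)`. [cite: GentryPeikertVaikuntanathan2008, §4.1] -/
def accept (ou : Fin (2 ^ (w + 1)) × Fin (2 ^ P)) : Prop :=
  (ou.2 : ℕ) < accNum θ c s N P (window c w ou.1)

/-- Acceptance is decidable (a comparison of naturals). [folklore] -/
instance (ou : Fin (2 ^ (w + 1)) × Fin (2 ^ P)) : Decidable (accept θ c s N P w ou) := by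
  unfold accept; infer_instance

/-- **The law of the sampler with `R` rounds** on uniform coins (`w + 1 + P` fresh bits per round): accept
the round's window point if its coin is below the acceptance numerator, else go on; after `R` failed
rounds output `round c`. [cite: GentryPeikertVaikuntanathan2008, §4.1 (SampleZ)] -/
def rejLaw : ℕ → PMF ℤ
  | 0 => PMF.pure (round c)
  | R + 1 => (PMF.uniformOfFintype (Fin (2 ^ (w + 1)) × Fin (2 ^ P))).bind fun ou =>
      if accept θ c s N P w ou then PMF.pure (window c w ou.1) else rejLaw R

/-- The total acceptance numerator `∑ₒ accNum(window o)`. [folklore] -/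
def accTot : ℕ := ∑ o : Fin (2 ^ (w + 1)), accNum θ c s N P (window c w o)

/-- The acceptance numerator as a function on `ℤ` (zero off the window). [folklore] -/
def accOn (x : ℤ) : ℕ := ∑ o : Fin (2 ^ (w + 1)), if window c w o = x then accNum θ c s N P (window c w o) else 0

/-- On the window, `accOn (window o) = accNum (window o)`. [folklore] -/
theorem accOn_window (o : Fin (2 ^ (w + 1))) : accOn θ c s N P w (window c w o) = accNum θ c s N P (window c w o) := by
  unfold accOn
  rw [Finset.sum_eq_single o]
  · rw [if_pos rfl]
  · intro o' _ ho'
    rw [if_neg (fun h => ho' (window_injective c w h))]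
  · intro h; exact absurd (Finset.mem_univ o) h

/-- Off the window, `accOn x = 0`. [folklore] -/
theorem accOn_of_not_mem {x : ℤ} (hx : x ∉ Set.range (window c w)) : accOn θ c s N P w x = 0 := by
  unfold accOn
  exact Finset.sum_eq_zero fun o _ => if_neg fun h => hx ⟨o, h⟩

/-- `∑ₓ accOn x = accTot` (as a sum over the window). [folklore] -/
theorem accTot_eq_sum_accOn : accTot θ c s N P w = ∑ o : Fin (2 ^ (w + 1)), accOn θ c s N P w (window c w o) := by
  unfold accTot
  exact Finset.sum_congr rfl fun o _ => (accOn_window θ c s N P w o).symm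

/-- `accTot ≤ 2^{w+1}·2ᴾ`. [folklore] -/
theorem accTot_le : accTot θ c s N P w ≤ 2 ^ (w + 1) * 2 ^ P := by
  unfold accTot
  calc ∑ o : Fin (2 ^ (w + 1)), accNum θ c s N P (window c w o) ≤ ∑ _o : Fin (2 ^ (w + 1)), 2 ^ P :=
        Finset.sum_le_sum fun o _ => accNum_le θ c s N P _
    _ = 2 ^ (w + 1) * 2 ^ P := by rw [Finset.sum_const, Finset.card_univ, Fintype.card_fin, smul_eq_mul]

/-- The number of `P`-bit coins below `k ≤ 2ᴾ` is `k`. [folklore] -/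
theorem sum_ite_lt_eq {M k : ℕ} (hk : k ≤ M) :
    ∑ u : Fin M, (if (u : ℕ) < k then (1 : ℝ≥0∞) else 0) = k := by
  rw [Finset.sum_boole]
  congr 1
  have hset : (Finset.univ.filter fun u : Fin M => (u : ℕ) < k) = (Finset.range k).attachFin (fun m hm => by
      rw [Finset.mem_range] at hm; omega) := by
    ext u
    simp [Finset.mem_attachFin]
  rw [hset, Finset.card_attachFin, Finset.card_range]

/-- **One step of the recursion**: `rejLaw (R+1) x = accOn(x)/(2^{w+1}2ᴾ) + (1 - accTot/(2^{w+1}2ᴾ))·rejLaw R x`.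
[cite: GentryPeikertVaikuntanathan2008, §4.1 (SampleZ: "otherwise repeat")] -/
theorem rejLaw_succ_apply (R : ℕ) (x : ℤ) :
    rejLaw θ c s N P w (R + 1) x =
      (accOn θ c s N P w x : ℝ≥0∞) / ((2 ^ (w + 1) * 2 ^ P : ℕ) : ℝ≥0∞) +
        ((2 ^ (w + 1) * 2 ^ P - accTot θ c s N P w : ℕ) : ℝ≥0∞) / ((2 ^ (w + 1) * 2 ^ P : ℕ) : ℝ≥0∞) *
          rejLaw θ c s N P w R x := by
  classical
  rw [rejLaw, PMF.bind_apply, tsum_fintype]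
  have hcard : (Fintype.card (Fin (2 ^ (w + 1)) × Fin (2 ^ P)) : ℝ≥0∞) = ((2 ^ (w + 1) * 2 ^ P : ℕ) : ℝ≥0∞) := by
    rw [Fintype.card_prod, Fintype.card_fin, Fintype.card_fin]
  simp_rw [PMF.uniformOfFintype_apply, hcard]
  rw [← Finset.mul_sum, Fintype.sum_prod_type]
  -- split each inner sum into the accepting and rejecting coins
  have hinner : ∀ o : Fin (2 ^ (w + 1)),
      ∑ u : Fin (2 ^ P), (if accept θ c s N P w (o, u) then PMF.pure (window c w o) else rejLaw θ c s N P w R) x =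
        (if window c w o = x then (accNum θ c s N P (window c w o) : ℝ≥0∞) else 0) +
          ((2 ^ P - accNum θ c s N P (window c w o) : ℕ) : ℝ≥0∞) * rejLaw θ c s N P w R x := by
    intro o
    have hsplit : ∀ u : Fin (2 ^ P),
        (if accept θ c s N P w (o, u) then PMF.pure (window c w o) else rejLaw θ c s N P w R) x =
          (if (u : ℕ) < accNum θ c s N P (window c w o) then (if window c w o = x then (1 : ℝ≥0∞) else 0) else 0) +
            (if (u : ℕ) < accNum θ c s N P (window c w o) then 0 else rejLaw θ c s N P w R x) := by
      intro u
      unfold accept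
      split_ifs with h1 h2
      · rw [PMF.pure_apply, if_pos h2.symm, add_zero]
      · rw [PMF.pure_apply, if_neg (Ne.symm h2), add_zero]
      · rw [zero_add]
    simp_rw [hsplit]
    rw [Finset.sum_add_distrib]
    congr 1
    · by_cases hx : window c w o = x
      · simp_rw [if_pos hx]
        exact sum_ite_lt_eq (accNum_le θ c s N P _)
      · simp_rw [if_neg hx]
        simp
    · have hmul : ∀ u : Fin (2 ^ P), (if (u : ℕ) < accNum θ c s N P (window c w o) then (0 : ℝ≥0∞) else rejLaw θ c s N P w R x) =
          (if (u : ℕ) < accNum θ c s N P (window c w o) then (0 : ℝ≥0∞) else 1) * rejLaw θ c s N P w R x := fun u => by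
        split_ifs <;> simp
      simp_rw [hmul]
      rw [← Finset.sum_mul]
      congr 1
      have h1 : ∑ u : Fin (2 ^ P), (if (u : ℕ) < accNum θ c s N P (window c w o) then (0 : ℝ≥0∞) else 1) +
          ∑ u : Fin (2 ^ P), (if (u : ℕ) < accNum θ c s N P (window c w o) then (1 : ℝ≥0∞) else 0) = (2 ^ P : ℕ) := by
        rw [← Finset.sum_add_distrib]
        have : ∀ u : Fin (2 ^ P), ((if (u : ℕ) < accNum θ c s N P (window c w o) then (0 : ℝ≥0∞) else 1) +
            (if (u : ℕ) < accNum θ c s N P (window c w o) then (1 : ℝ≥0∞) else 0)) = 1 := fun u => by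
          split_ifs <;> simp
        simp_rw [this]
        rw [Finset.sum_const, Finset.card_univ, Fintype.card_fin, nsmul_eq_mul, mul_one]
      rw [sum_ite_lt_eq (accNum_le θ c s N P _)] at h1
      have hle := accNum_le θ c s N P (window c w o)
      have h2 : ((2 ^ P : ℕ) : ℝ≥0∞) = ((2 ^ P - accNum θ c s N P (window c w o) : ℕ) : ℝ≥0∞) + (accNum θ c s N P (window c w o) : ℝ≥0∞) := by
        rw [← Nat.cast_add, Nat.sub_add_cancel hle]
      have hfin : (accNum θ c s N P (window c w o) : ℝ≥0∞) ≠ ∞ := ENNReal.natCast_ne_top _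
      have := h1.trans h2
      exact (ENNReal.add_left_inj hfin).1 (by rw [this])
  simp_rw [hinner]
  rw [Finset.sum_add_distrib, mul_add, ← Finset.sum_mul, ← mul_assoc]
  congr 1
  · rw [accOn]; push_cast
    rw [ENNReal.div_eq_inv_mul]
  · rw [ENNReal.div_eq_inv_mul]
    congr 2
    rw [accTot]
    have h : ∑ o : Fin (2 ^ (w + 1)), ((2 ^ P - accNum θ c s N P (window c w o) : ℕ) : ℝ≥0∞) =
        ((∑ o : Fin (2 ^ (w + 1)), (2 ^ P - accNum θ c s N P (window c w o)) : ℕ) : ℝ≥0∞) := by push_cast; rfl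
    rw [h]
    congr 1
    have hle : ∀ o ∈ (Finset.univ : Finset (Fin (2 ^ (w + 1)))), accNum θ c s N P (window c w o) ≤ 2 ^ P :=
      fun o _ => accNum_le θ c s N P _
    rw [Finset.sum_tsub_distrib _ hle, Finset.sum_const, Finset.card_univ, Fintype.card_fin, smul_eq_mul]

/-! ### The closed form of the law -/

/-- The number of coin pairs of one round, as a real. [folklore] -/
def cardR (w P : ℕ) : ℝ := ((2 ^ (w + 1) * 2 ^ P : ℕ) : ℝ)

/-- `0 < cardR`. [folklore] -/
theorem cardR_pos (w P : ℕ) : 0 < cardR w P := by unfold cardR; positivity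

/-- **The acceptance probability of one round**: `A = accTot/(2^{w+1}·2ᴾ)`. [cite: GentryPeikertVaikuntanathan2008, Lemma 4.2 (proof: "the probability that … outputs in a given iteration")] -/
def accProb : ℝ := (accTot θ c s N P w : ℝ) / cardR w P

/-- `0 ≤ A ≤ 1`. [folklore] -/
theorem accProb_mem : 0 ≤ accProb θ c s N P w ∧ accProb θ c s N P w ≤ 1 := by
  unfold accProb
  refine ⟨div_nonneg (Nat.cast_nonneg _) (cardR_pos w P).le, ?_⟩
  rw [div_le_one (cardR_pos w P)]
  unfold cardR
  exact_mod_cast accTot_le θ c s N P w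

/-- The recursion in real form: `E_{R+1}(x) = accOn(x)/card + (1 - A)·E_R(x)`. [cite: GentryPeikertVaikuntanathan2008, §4.1 (SampleZ: "otherwise repeat")] -/
theorem rejLaw_succ_toReal (R : ℕ) (x : ℤ) :
    (rejLaw θ c s N P w (R + 1) x).toReal =
      (accOn θ c s N P w x : ℝ) / cardR w P + (1 - accProb θ c s N P w) * (rejLaw θ c s N P w R x).toReal := by
  rw [rejLaw_succ_apply]
  have hc0 : ((2 ^ (w + 1) * 2 ^ P : ℕ) : ℝ≥0∞) ≠ 0 := by positivity
  have hct : ((2 ^ (w + 1) * 2 ^ P : ℕ) : ℝ≥0∞) ≠ ∞ := ENNReal.natCast_ne_top _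
  have h1 : (accOn θ c s N P w x : ℝ≥0∞) / ((2 ^ (w + 1) * 2 ^ P : ℕ) : ℝ≥0∞) ≠ ∞ :=
    ENNReal.div_ne_top (ENNReal.natCast_ne_top _) hc0
  have h2 : ((2 ^ (w + 1) * 2 ^ P - accTot θ c s N P w : ℕ) : ℝ≥0∞) / ((2 ^ (w + 1) * 2 ^ P : ℕ) : ℝ≥0∞) ≠ ∞ :=
    ENNReal.div_ne_top (ENNReal.natCast_ne_top _) hc0
  rw [ENNReal.toReal_add h1 (ENNReal.mul_ne_top h2 (PMF.apply_ne_top _ _)), ENNReal.toReal_mul,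
    ENNReal.toReal_div, ENNReal.toReal_div, ENNReal.toReal_natCast, ENNReal.toReal_natCast, ENNReal.toReal_natCast]
  congr 1
  unfold accProb cardR
  rw [Nat.cast_sub (accTot_le θ c s N P w), sub_div, div_self (ne_of_gt (by positivity))]

/-- **The closed form**: `E_R(x) = accOn(x)/card · ∑_{r<R} (1-A)ʳ + (1-A)ᴿ · [x = round c]`. [cite: GentryPeikertVaikuntanathan2008, §4.1 (SampleZ: "otherwise repeat")] -/
theorem rejLaw_toReal (R : ℕ) (x : ℤ) :
    (rejLaw θ c s N P w R x).toReal =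
      (accOn θ c s N P w x : ℝ) / cardR w P * (∑ r ∈ range R, (1 - accProb θ c s N P w) ^ r) +
        (1 - accProb θ c s N P w) ^ R * (if x = round c then 1 else 0) := by
  induction R with
  | zero =>
    rw [rejLaw, PMF.pure_apply]
    split_ifs <;> simp
  | succ R ih =>
    rw [rejLaw_succ_toReal, ih, Finset.sum_range_succ', pow_zero]
    simp only [pow_succ']
    rw [← Finset.mul_sum]
    ring

/-! ### The Gaussian weights and the target law -/

/-- The true weight `g(x) = e^{-θ(x-c)²}`. [cite: GentryPeikertVaikuntanathan2008, §4.1 (`ρ_s(x - c)`)] -/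
def gfun (θ c : ℚ) (x : ℤ) : ℝ := Real.exp (-((θ : ℝ) * ((x : ℝ) - c) ^ 2))

/-- `0 < g(x)`. [folklore] -/
theorem gfun_pos (θ c : ℚ) (x : ℤ) : 0 < gfun θ c x := Real.exp_pos _

/-- `ρ_{√(π/θ)}(t) = e^{-θt²}` on the real line. [folklore] -/
theorem gaussianFunction_sqrt_pi_div {θ : ℚ} (hθ : 0 < θ) (t : ℝ) :
    Literature.Algebra.EuclideanLattices.gaussianFunction (Real.sqrt (π / θ)) t = Real.exp (-((θ : ℝ) * t ^ 2)) := by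
  unfold Literature.Algebra.EuclideanLattices.gaussianFunction
  have hθ' : (0 : ℝ) < θ := by exact_mod_cast hθ
  rw [Real.sq_sqrt (by positivity), Real.norm_eq_abs, sq_abs]
  congr 1
  field_simp

/-- The total mass `Z = ρ_{√(π/θ),c}(ℤ) = ∑_{x ∈ ℤ} e^{-θ(x-c)²}` as a real. [folklore] -/
def Zr (θ c : ℚ) : ℝ := (Literature.Algebra.EuclideanLattices.gaussianMassInt (Real.sqrt (π / θ)) c).toReal

/-- `∑ₓ g(x) = Z` (the Gaussian weights are summable with sum `Z`). [folklore] -/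
theorem hasSum_gfun {θ : ℚ} (hθ : 0 < θ) (c : ℚ) : HasSum (gfun θ c) (Zr θ c) := by
  have hθ' : (0 : ℝ) < θ := by exact_mod_cast hθ
  have hs : Real.sqrt (π / θ) ≠ 0 := (Real.sqrt_pos.2 (by positivity)).ne'
  have hne := Literature.Algebra.EuclideanLattices.gaussianMassInt_ne_top hs (c : ℝ)
  unfold Literature.Algebra.EuclideanLattices.gaussianMassInt at hne
  have hsum := ENNReal.summable_toReal hne
  have hfun : (fun k : ℤ => (ENNReal.ofReal (Literature.Algebra.EuclideanLattices.gaussianFunction (Real.sqrt (π / θ))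
      ((k : ℝ) - c))).toReal) = gfun θ c := by
    funext k
    rw [ENNReal.toReal_ofReal (Literature.Algebra.EuclideanLattices.gaussianFunction_pos _ _).le,
      gaussianFunction_sqrt_pi_div hθ]
    rfl
  rw [hfun] at hsum
  have heq : Zr θ c = ∑' k, gfun θ c k := by
    unfold Zr Literature.Algebra.EuclideanLattices.gaussianMassInt
    rw [ENNReal.tsum_toReal_eq (fun _ => ENNReal.ofReal_ne_top), hfun]
  rw [heq]
  exact hsum.hasSum

/-- `0 < Z`. [folklore] -/
theorem Zr_pos {θ : ℚ} (hθ : 0 < θ) (c : ℚ) : 0 < Zr θ c := by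
  have h := hasSum_gfun hθ c
  calc (0 : ℝ) < gfun θ c 0 := gfun_pos θ c 0
    _ = ∑ x ∈ ({0} : Finset ℤ), gfun θ c x := by simp
    _ ≤ Zr θ c := sum_le_hasSum _ (fun x _ => (gfun_pos θ c x).le) h

/-- **The target law in real form**: `D_{ℤ,√(π/θ),c}(x) = g(x)/Z`. [cite: GentryPeikertVaikuntanathan2008, §4.1] -/
theorem discreteGaussianInt_toReal {θ : ℚ} (hθ : 0 < θ) (c : ℚ) (x : ℤ) :
    (Literature.Algebra.EuclideanLattices.discreteGaussianInt (Real.sqrt (π / θ)) c x).toReal = gfun θ c x / Zr θ c := by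
  have hθ' : (0 : ℝ) < θ := by exact_mod_cast hθ
  have hs : 0 < Real.sqrt (π / θ) := Real.sqrt_pos.2 (by positivity)
  rw [Literature.Algebra.EuclideanLattices.discreteGaussianInt_apply hs, ENNReal.toReal_mul, ENNReal.toReal_inv,
    ENNReal.toReal_ofReal (Literature.Algebra.EuclideanLattices.gaussianFunction_pos _ _).le,
    gaussianFunction_sqrt_pi_div hθ, div_eq_mul_inv]
  rfl

/-- The Gaussian mass of the window `G_W = ∑ₒ g(window o)`. [folklore] -/
def GW (θ c : ℚ) (w : ℕ) : ℝ := ∑ o : Fin (2 ^ (w + 1)), gfun θ c (window c w o)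

/-- The window as a finite set of integers. [folklore] -/
def Wset (c : ℚ) (w : ℕ) : Finset ℤ := Finset.univ.image (window c w)

/-- Sums over the window set are sums over the window index. [folklore] -/
theorem sum_Wset {M : Type*} [AddCommMonoid M] (c : ℚ) (w : ℕ) (f : ℤ → M) :
    ∑ x ∈ Wset c w, f x = ∑ o : Fin (2 ^ (w + 1)), f (window c w o) := by
  unfold Wset
  rw [Finset.sum_image fun o _ o' _ h => window_injective c w h]

/-- Membership in the window set. [folklore] -/
theorem mem_Wset_iff (c : ℚ) (w : ℕ) (x : ℤ) : x ∈ Wset c w ↔ x ∈ Set.range (window c w) := by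
  unfold Wset
  simp only [Finset.mem_image, Finset.mem_univ, true_and, Set.mem_range]

/-- `round c` lies in the window (`o = 2ʷ`). [folklore] -/
theorem round_mem_Wset (c : ℚ) (w : ℕ) : round c ∈ Wset c w := by
  rw [mem_Wset_iff, mem_range_window_iff]
  have : (0 : ℤ) < 2 ^ w := by positivity
  constructor <;> simp

/-- `G_W ≤ Z`. [folklore] -/
theorem GW_le_Zr {θ : ℚ} (hθ : 0 < θ) (c : ℚ) (w : ℕ) : GW θ c w ≤ Zr θ c := by
  unfold GW
  rw [← sum_Wset c w (gfun θ c)]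
  exact sum_le_hasSum _ (fun x _ => (gfun_pos θ c x).le) (hasSum_gfun hθ c)

/-- `0 < G_W`. [folklore] -/
theorem GW_pos (θ c : ℚ) (w : ℕ) : 0 < GW θ c w := by
  unfold GW
  have hne : (Finset.univ : Finset (Fin (2 ^ (w + 1)))).Nonempty := Finset.univ_nonempty
  exact Finset.sum_pos (fun o _ => gfun_pos θ c _) hne

/-! ### Normalising two nonnegative vectors -/

/-- **Normalisation is stable**: for nonnegative `u, v` on a finite index set with `∑u = U > 0`, `∑v = V > 0`,
`∑ᵢ |uᵢ/U - vᵢ/V| ≤ 2·(∑ᵢ |uᵢ - vᵢ|)/V`. [folklore] -/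
theorem sum_abs_div_sub_div_le {ι : Type*} (S : Finset ι) (u v : ι → ℝ) (hu : ∀ i ∈ S, 0 ≤ u i)
    {U V : ℝ} (hU : ∑ i ∈ S, u i = U) (hV : ∑ i ∈ S, v i = V) (hU0 : 0 < U) (hV0 : 0 < V) :
    ∑ i ∈ S, |u i / U - v i / V| ≤ 2 * (∑ i ∈ S, |u i - v i|) / V := by
  have hsplit : ∀ i ∈ S, |u i / U - v i / V| ≤ |u i - v i| / V + u i * |1 / U - 1 / V| := by
    intro i hi
    have : u i / U - v i / V = (u i - v i) / V + u i * (1 / U - 1 / V) := by ring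
    rw [this]
    refine (abs_add_le _ _).trans ?_
    rw [abs_div, abs_of_pos hV0, abs_mul, abs_of_nonneg (hu i hi)]
  refine (Finset.sum_le_sum hsplit).trans ?_
  rw [Finset.sum_add_distrib, ← Finset.sum_div, ← Finset.sum_mul, hU]
  -- `U·|1/U - 1/V| = |V - U|/V ≤ (∑|u - v|)/V`
  have hUV : U * |1 / U - 1 / V| = |V - U| / V := by
    rw [show 1 / U - 1 / V = (V - U) / (U * V) by field_simp, abs_div, abs_of_pos (mul_pos hU0 hV0)]
    field_simp
  rw [hUV]
  have hdiff : |V - U| ≤ ∑ i ∈ S, |u i - v i| := by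
    rw [← hU, ← hV, ← Finset.sum_sub_distrib]
    exact (Finset.abs_sum_le_sum_abs _ _).trans (le_of_eq (Finset.sum_congr rfl fun i _ => abs_sub_comm _ _))
  rw [← add_div, div_le_div_iff_of_pos_right hV0]
  linarith

/-! ### The statistical distance to the discrete Gaussian -/

/-- **The law of the sampler against `D_{ℤ,√(π/θ),c}`**: if every acceptance probability on the window is
within `η` of the true weight (`|accNum/2ᴾ - e^{-θ(x-c)²}| ≤ η`) and some point is acceptable at all, then
after `R` rounds
`Δ(rejLaw R, D_{ℤ,√(π/θ),c}) ≤ (1 - A)ᴿ + 2^{w+1}η/G_W + (Z - G_W)/Z`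
— no acceptance in `R` rounds, the distortion of the weights on the window, and the Gaussian mass outside
the window. [cite: GentryPeikertVaikuntanathan2008, Lemma 4.2 (proof)] -/
theorem tvDist_rejLaw_discreteGaussianInt_le {θ : ℚ} (hθ : 0 < θ) (c : ℚ) (s N P w : ℕ) {η : ℝ}
    (hη : ∀ o : Fin (2 ^ (w + 1)), |(accNum θ c s N P (window c w o) : ℝ) / 2 ^ P - gfun θ c (window c w o)| ≤ η)
    (hacc : 0 < accTot θ c s N P w) (R : ℕ) :
    (rejLaw θ c s N P w R).tvDist (Literature.Algebra.EuclideanLattices.discreteGaussianInt (Real.sqrt (π / θ)) c) ≤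
      (1 - accProb θ c s N P w) ^ R + 2 ^ (w + 1) * η / GW θ c w + (Zr θ c - GW θ c w) / Zr θ c := by
  classical
  -- abbreviations
  set q : ℝ := 1 - accProb θ c s N P w with hq
  obtain ⟨hA0, hA1⟩ := accProb_mem θ c s N P w
  have hq0 : 0 ≤ q := by rw [hq]; linarith
  set Tt : ℝ := (accTot θ c s N P w : ℝ) with hTt
  have hTt0 : 0 < Tt := by rw [hTt]; exact_mod_cast hacc
  set G : ℝ := GW θ c w with hG
  set Z : ℝ := Zr θ c with hZ
  have hG0 : 0 < G := GW_pos θ c w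
  have hZ0 : 0 < Z := Zr_pos hθ c
  have hGZ : G ≤ Z := GW_le_Zr hθ c w
  set g : ℤ → ℝ := gfun θ c with hg
  set W : Finset ℤ := Wset c w with hW
  set a : ℤ → ℝ := fun x => (accOn θ c s N P w x : ℝ) / Tt with ha
  set δf : ℤ → ℝ := fun x => if x = round c then 1 else 0 with hδf
  set b : ℤ → ℝ := fun x => if x ∈ W then g x / G else 0 with hb
  set Dpmf := Literature.Algebra.EuclideanLattices.discreteGaussianInt (Real.sqrt (π / θ)) c with hDpmf
  set Epmf := rejLaw θ c s N P w R with hEpmf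
  -- supports
  have ha_off : ∀ x ∉ W, a x = 0 := fun x hx => by
    simp only [ha]
    rw [accOn_of_not_mem θ c s N P w (by rwa [← mem_Wset_iff]), Nat.cast_zero, zero_div]
  have hδ_off : ∀ x ∉ W, δf x = 0 := fun x hx => by
    simp only [hδf]
    rw [if_neg]
    rintro rfl
    exact hx (round_mem_Wset c w)
  have hb_off : ∀ x ∉ W, b x = 0 := fun x hx => by simp only [hb, if_neg hx]
  have ha0 : ∀ x, 0 ≤ a x := fun x => by positivity
  -- the closed form: `E(x) = a(x)(1 - qᴿ) + qᴿ δ(x)`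
  have hgeom : accProb θ c s N P w * ∑ r ∈ range R, q ^ r = 1 - q ^ R := by
    have h := geom_sum_mul q R
    rw [hq] at h ⊢
    linear_combination -h
  have hE : ∀ x, (Epmf x).toReal = a x * (1 - q ^ R) + q ^ R * δf x := by
    intro x
    rw [hEpmf, rejLaw_toReal, ← hgeom]
    have hc : cardR w P ≠ 0 := (cardR_pos w P).ne'
    have hax : (accOn θ c s N P w x : ℝ) / cardR w P = a x * accProb θ c s N P w := by
      simp only [ha, accProb, hTt]
      field_simp
    rw [hax]
    simp only [hδf]
    ring
  have hD : ∀ x, (Dpmf x).toReal = g x / Z := fun x => discreteGaussianInt_toReal hθ c x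
  -- pointwise decomposition
  have hpt : ∀ x, |(Epmf x).toReal - (Dpmf x).toReal| ≤ q ^ R * (a x + δf x) + |a x - b x| + |b x - g x / Z| := by
    intro x
    rw [hE, hD]
    have hsplit : a x * (1 - q ^ R) + q ^ R * δf x - g x / Z =
        q ^ R * (δf x - a x) + ((a x - b x) + (b x - g x / Z)) := by ring
    rw [hsplit]
    have hδ0 : 0 ≤ δf x := by simp only [hδf]; split_ifs <;> norm_num
    have h1 : |q ^ R * (δf x - a x)| ≤ q ^ R * (a x + δf x) := by
      rw [abs_mul, abs_of_nonneg (pow_nonneg hq0 R)]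
      refine mul_le_mul_of_nonneg_left ?_ (pow_nonneg hq0 R)
      calc |δf x - a x| ≤ |δf x| + |a x| := abs_sub _ _
        _ = a x + δf x := by rw [abs_of_nonneg hδ0, abs_of_nonneg (ha0 x), add_comm]
    calc |q ^ R * (δf x - a x) + (a x - b x + (b x - g x / Z))|
        ≤ |q ^ R * (δf x - a x)| + |a x - b x + (b x - g x / Z)| := abs_add_le _ _
      _ ≤ q ^ R * (a x + δf x) + (|a x - b x| + |b x - g x / Z|) := add_le_add h1 (abs_add_le _ _)
      _ = _ := by ring
  -- the third term, rewritten: `|b - g/Z| = g/Z + 1_W · g · (1/G - 2/Z)`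
  have hF3 : ∀ x, |b x - g x / Z| = g x / Z + (if x ∈ W then g x * (1 / G - 2 / Z) else 0) := by
    intro x
    have hgx : 0 < g x := gfun_pos θ c x
    by_cases hx : x ∈ W
    · simp only [hb, if_pos hx]
      have h1 : g x / Z ≤ g x / G := div_le_div_of_nonneg_left hgx.le hG0 hGZ
      rw [abs_of_nonneg (by linarith)]
      field_simp
      ring
    · simp only [hb, if_neg hx, zero_sub, abs_neg, add_zero]
      exact abs_of_nonneg (div_nonneg hgx.le hZ0.le)
  -- sums of the pieces
  have hsum_a : ∑ x ∈ W, a x = 1 := by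
    rw [hW, sum_Wset]
    simp only [ha]
    rw [← Finset.sum_div, ← Nat.cast_sum, ← accTot_eq_sum_accOn, ← hTt, div_self hTt0.ne']
  have hsum_δ : ∑ x ∈ W, δf x = 1 := by
    simp only [hδf]
    rw [Finset.sum_ite_eq', if_pos (by rw [hW]; exact round_mem_Wset c w)]
  have hsum_g : ∑ x ∈ W, g x = G := by rw [hW, sum_Wset]; rfl
  have hS1 : HasSum (fun x => q ^ R * (a x + δf x)) (q ^ R * 2) := by
    have h : HasSum (fun x => a x + δf x) (∑ x ∈ W, (a x + δf x)) :=
      hasSum_sum_of_ne_finset_zero (fun x hx => by simp only [ha_off x hx, hδ_off x hx, add_zero])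
    rw [Finset.sum_add_distrib, hsum_a, hsum_δ, show (1 : ℝ) + 1 = 2 by norm_num] at h
    exact h.mul_left _
  have hS2 : HasSum (fun x => |a x - b x|) (∑ x ∈ W, |a x - b x|) :=
    hasSum_sum_of_ne_finset_zero fun x hx => by rw [ha_off x hx, hb_off x hx, sub_zero, abs_zero]
  have hS3 : HasSum (fun x => g x / Z + (if x ∈ W then g x * (1 / G - 2 / Z) else 0)) (1 + G * (1 / G - 2 / Z)) := by
    refine HasSum.add ?_ ?_
    · have h := (hasSum_gfun hθ c).div_const Z
      rwa [← hZ, div_self hZ0.ne'] at h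
    · have h : HasSum (fun x => if x ∈ W then g x * (1 / G - 2 / Z) else 0)
          (∑ x ∈ W, (if x ∈ W then g x * (1 / G - 2 / Z) else 0)) :=
        hasSum_sum_of_ne_finset_zero (fun x hx => if_neg hx)
      have hs : ∑ x ∈ W, (if x ∈ W then g x * (1 / G - 2 / Z) else 0) = G * (1 / G - 2 / Z) := by
        rw [Finset.sum_ite_of_true (fun x hx => hx), ← Finset.sum_mul, hsum_g]
      rwa [hs] at h
  have hF : HasSum (fun x => q ^ R * (a x + δf x) + |a x - b x| + |b x - g x / Z|)
      (q ^ R * 2 + ∑ x ∈ W, |a x - b x| + (1 + G * (1 / G - 2 / Z))) := by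
    have h3 : HasSum (fun x => |b x - g x / Z|) (1 + G * (1 / G - 2 / Z)) := by
      convert hS3 using 1
      funext x; exact hF3 x
    exact (hS1.add hS2).add h3
  -- the window term
  have hwin : ∑ x ∈ W, |a x - b x| ≤ 2 * (2 ^ (w + 1) * η) / G := by
    rw [hW, sum_Wset]
    have h2P : (0 : ℝ) < 2 ^ P := by positivity
    have hmain := sum_abs_div_sub_div_le (Finset.univ : Finset (Fin (2 ^ (w + 1))))
      (fun o => (accNum θ c s N P (window c w o) : ℝ) / 2 ^ P) (fun o => g (window c w o))
      (fun o _ => by positivity) (U := Tt / 2 ^ P) (V := G)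
      (by rw [← Finset.sum_div, hTt, accTot]; push_cast; rfl) (by rw [hG, GW]) (by positivity) hG0
    have hrew : ∀ o : Fin (2 ^ (w + 1)), |a (window c w o) - b (window c w o)| =
        |(accNum θ c s N P (window c w o) : ℝ) / 2 ^ P / (Tt / 2 ^ P) - g (window c w o) / G| := by
      intro o
      simp only [ha, hb, hW, if_pos ((mem_Wset_iff c w _).2 ⟨o, rfl⟩), accOn_window]
      congr 2
      field_simp
    simp_rw [hrew]
    refine hmain.trans ?_
    have hηsum : ∑ o : Fin (2 ^ (w + 1)), |(accNum θ c s N P (window c w o) : ℝ) / 2 ^ P - g (window c w o)| ≤ 2 ^ (w + 1) * η := by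
      calc ∑ o : Fin (2 ^ (w + 1)), |(accNum θ c s N P (window c w o) : ℝ) / 2 ^ P - g (window c w o)|
          ≤ ∑ _o : Fin (2 ^ (w + 1)), η := Finset.sum_le_sum fun o _ => hη o
        _ = 2 ^ (w + 1) * η := by
            rw [Finset.sum_const, Finset.card_univ, Fintype.card_fin, nsmul_eq_mul]; push_cast; ring
    rw [div_le_div_iff_of_pos_right hG0]
    linarith
  -- assemble
  rw [PMF.tvDist]
  have hle := hasSum_le hpt (PMF.summable_abs_toReal_sub_toReal Epmf Dpmf).hasSum hF
  have htot : q ^ R * 2 + ∑ x ∈ W, |a x - b x| + (1 + G * (1 / G - 2 / Z)) ≤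
      2 * (q ^ R + 2 ^ (w + 1) * η / G + (Z - G) / Z) := by
    have h1 : 1 + G * (1 / G - 2 / Z) = 2 * ((Z - G) / Z) := by field_simp; ring
    rw [h1]
    have h2 : 2 * (2 ^ (w + 1) * η) / G = 2 * (2 ^ (w + 1) * η / G) := by ring
    rw [h2] at hwin
    linarith
  calc 2⁻¹ * ∑' x, |(Epmf x).toReal - (Dpmf x).toReal|
      ≤ 2⁻¹ * (q ^ R * 2 + ∑ x ∈ W, |a x - b x| + (1 + G * (1 / G - 2 / Z))) :=
        mul_le_mul_of_nonneg_left hle (by norm_num)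
    _ ≤ 2⁻¹ * (2 * (q ^ R + 2 ^ (w + 1) * η / G + (Z - G) / Z)) := mul_le_mul_of_nonneg_left htot (by norm_num)
    _ = q ^ R + 2 ^ (w + 1) * η / G + (Z - G) / Z := by ring

/-! ### The hypotheses of the estimate from the parameters -/

/-- **Accuracy on the window**: if `θ·(2ʷ + 1/2)² ≤ 2ˢ` (so that the reduced Taylor argument is `≤ 1` on
the whole window) and `N ≥ 1`, then `|accNum(x)/2ᴾ - e^{-θ(x-c)²}| ≤ 2^{s+1}/N! + 2⁻ᴾ` at every window point.
[folklore] -/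
theorem abs_accNum_window_sub_le {θ : ℚ} (hθ : 0 ≤ θ) (c : ℚ) {s N : ℕ} (P w : ℕ)
    (hs : (θ : ℝ) * (2 ^ w + 1 / 2) ^ 2 ≤ 2 ^ s) (hN : 1 ≤ N) (o : Fin (2 ^ (w + 1))) :
    |(accNum θ c s N P (window c w o) : ℝ) / 2 ^ P - gfun θ c (window c w o)| ≤ 2 ^ (s + 1) / N.factorial + 1 / 2 ^ P := by
  have hθ' : (0 : ℝ) ≤ θ := by exact_mod_cast hθ
  refine abs_accNum_div_sub_exp_le hθ P (window c w o) ?_ hN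
  have hwin := abs_window_sub_le c w o
  have h0 : 0 ≤ |((window c w o : ℤ) : ℝ) - (c : ℝ)| := abs_nonneg _
  have hcast : ((θ * (((window c w o : ℤ) : ℚ) - c) ^ 2 : ℚ) : ℝ) = (θ : ℝ) * (((window c w o : ℤ) : ℝ) - (c : ℝ)) ^ 2 := by
    push_cast; ring
  rw [hcast]
  calc (θ : ℝ) * (((window c w o : ℤ) : ℝ) - (c : ℝ)) ^ 2 = (θ : ℝ) * |((window c w o : ℤ) : ℝ) - (c : ℝ)| ^ 2 := by
        rw [sq_abs]
    _ ≤ (θ : ℝ) * (2 ^ w + 1 / 2) ^ 2 := mul_le_mul_of_nonneg_left (pow_le_pow_left₀ h0 hwin 2) hθ'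
    _ ≤ 2 ^ s := hs

/-- The centre point `round c` has weight `≥ e^{-θ/4}` (`|round c - c| ≤ 1/2`). [folklore] -/
theorem exp_neg_le_gfun_round {θ : ℚ} (hθ : 0 ≤ θ) (c : ℚ) : Real.exp (-(θ : ℝ) / 4) ≤ gfun θ c (round c) := by
  unfold gfun
  refine Real.exp_le_exp.2 ?_
  have hθ' : (0 : ℝ) ≤ θ := by exact_mod_cast hθ
  have hrc : |((round c : ℤ) : ℝ) - (c : ℝ)| ≤ 1 / 2 := by
    have h := abs_sub_round (c : ℝ)
    rw [abs_sub_comm] at h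
    have : ((round c : ℤ) : ℝ) = ((round (c : ℝ) : ℤ) : ℝ) := by rw [Rat.round_cast]
    rw [this]; exact h
  have hsq : (((round c : ℤ) : ℝ) - c) ^ 2 ≤ 1 / 4 := by
    rw [← sq_abs]
    nlinarith [abs_nonneg (((round c : ℤ) : ℝ) - c)]
  nlinarith [mul_le_mul_of_nonneg_left hsq hθ']

/-- **Some point is acceptable**: if the window accuracy is `η ≤ 1/2` and `θ ≤ 1`, then `accNum(round c) ≥ 1`,
hence `accTot > 0`. [folklore] -/
theorem accTot_pos {θ : ℚ} (hθ : 0 ≤ θ) (hθ1 : θ ≤ 1) (c : ℚ) (s N P w : ℕ) {η : ℝ} (hη : η ≤ 1 / 2)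
    (hacc : ∀ o : Fin (2 ^ (w + 1)), |(accNum θ c s N P (window c w o) : ℝ) / 2 ^ P - gfun θ c (window c w o)| ≤ η) :
    0 < accTot θ c s N P w := by
  -- the index of `round c`
  obtain ⟨o, ho⟩ : round c ∈ Set.range (window c w) := (mem_Wset_iff c w _).1 (round_mem_Wset c w)
  have h1 : 1 ≤ accNum θ c s N P (window c w o) := by
    have h := hacc o
    rw [ho] at h
    have hg := exp_neg_le_gfun_round hθ c
    have he : (1 / 2 : ℝ) < Real.exp (-(θ : ℝ) / 4) := by
      have hθ' : (θ : ℝ) ≤ 1 := by exact_mod_cast hθ1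
      calc (1 / 2 : ℝ) < Real.exp (-1 / 4 : ℝ) := by
            have := Real.add_one_le_exp (-1 / 4 : ℝ)
            linarith
        _ ≤ Real.exp (-(θ : ℝ) / 4) := Real.exp_le_exp.2 (by linarith)
    have hpos : (0 : ℝ) < (accNum θ c s N P (window c w o) : ℝ) / 2 ^ P := by
      have := (abs_le.1 h).1
      rw [ho]
      linarith
    have : (0 : ℝ) < accNum θ c s N P (window c w o) := by
      have h2P : (0 : ℝ) < 2 ^ P := by positivity
      have := mul_pos hpos h2P
      rwa [div_mul_cancel₀ _ h2P.ne'] at this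
    exact_mod_cast this
  unfold accTot
  calc 0 < 1 := one_pos
    _ ≤ accNum θ c s N P (window c w o) := h1
    _ ≤ ∑ o' : Fin (2 ^ (w + 1)), accNum θ c s N P (window c w o') :=
        Finset.single_le_sum (f := fun o' => accNum θ c s N P (window c w o')) (fun o' _ => Nat.zero_le _)
          (Finset.mem_univ o)

/-- **The acceptance probability from below**: `A ≥ G_W/2^{w+1} - η`. [cite: GentryPeikertVaikuntanathan2008, Lemma 4.2 (proof)] -/
theorem accProb_ge (θ c : ℚ) (s N P w : ℕ) {η : ℝ}
    (hacc : ∀ o : Fin (2 ^ (w + 1)), |(accNum θ c s N P (window c w o) : ℝ) / 2 ^ P - gfun θ c (window c w o)| ≤ η) :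
    GW θ c w / 2 ^ (w + 1) - η ≤ accProb θ c s N P w := by
  unfold accProb cardR GW accTot
  have h2P : (0 : ℝ) < 2 ^ P := by positivity
  have h2w : (0 : ℝ) < 2 ^ (w + 1) := by positivity
  have hsum : ∑ o : Fin (2 ^ (w + 1)), (gfun θ c (window c w o) - η) ≤
      ∑ o : Fin (2 ^ (w + 1)), (accNum θ c s N P (window c w o) : ℝ) / 2 ^ P :=
    Finset.sum_le_sum fun o _ => by have := (abs_le.1 (hacc o)).1; linarith
  rw [Finset.sum_sub_distrib, Finset.sum_const, Finset.card_univ, Fintype.card_fin, nsmul_eq_mul, ← Finset.sum_div] at hsum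
  push_cast at hsum ⊢
  rw [show ((2 : ℝ) ^ (w + 1) * 2 ^ P) = 2 ^ P * 2 ^ (w + 1) by ring, ← div_div, le_div_iff₀ h2w]
  have hx : ((∑ o : Fin (2 ^ (w + 1)), gfun θ c (window c w o)) / 2 ^ (w + 1) - η) * 2 ^ (w + 1) =
      (∑ o : Fin (2 ^ (w + 1)), gfun θ c (window c w o)) - 2 ^ (w + 1) * η := by
    field_simp
  rw [hx]
  linarith

/-- **The window mass from below**: if `θ ≤ 1`, `θ(m + 1/2)² ≤ 1` and the `m + 1` points
`round c, …, round c + m` lie in the window (`m + 1 ≤ 2ʷ`), then `G_W ≥ (m + 1)·e⁻¹`. [folklore] -/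
theorem GW_ge {θ : ℚ} (hθ : 0 ≤ θ) (c : ℚ) (w m : ℕ) (hm : (θ : ℝ) * ((m : ℝ) + 1 / 2) ^ 2 ≤ 1) (hmw : m + 1 ≤ 2 ^ w) :
    ((m : ℝ) + 1) * Real.exp (-1) ≤ GW θ c w := by
  have hθ' : (0 : ℝ) ≤ θ := by exact_mod_cast hθ
  -- the indices of `round c + j`, `j ≤ m`
  have hidx : ∀ j : Fin (m + 1), 2 ^ w + (j : ℕ) < 2 ^ (w + 1) := fun j => by
    have := j.isLt; rw [pow_succ]; omega
  set ι : Fin (m + 1) → Fin (2 ^ (w + 1)) := fun j => ⟨2 ^ w + (j : ℕ), hidx j⟩ with hι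
  have hιinj : Function.Injective ι := fun j j' h => by
    simp only [hι, Fin.mk.injEq] at h
    exact Fin.ext (by omega)
  have hwin : ∀ j : Fin (m + 1), window c w (ι j) = round c + (j : ℕ) := fun j => by
    simp only [hι, window]; push_cast; ring
  -- each of these points has weight `≥ e⁻¹`
  have hpt : ∀ j : Fin (m + 1), Real.exp (-1) ≤ gfun θ c (window c w (ι j)) := by
    intro j
    rw [hwin j]
    unfold gfun
    refine Real.exp_le_exp.2 ?_
    have hrc : |((round c : ℤ) : ℝ) - (c : ℝ)| ≤ 1 / 2 := by
      have h := abs_sub_round (c : ℝ)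
      rw [abs_sub_comm] at h
      have : ((round c : ℤ) : ℝ) = ((round (c : ℝ) : ℤ) : ℝ) := by rw [Rat.round_cast]
      rw [this]; exact h
    have hj : ((j : ℕ) : ℝ) ≤ m := by exact_mod_cast Nat.lt_succ_iff.1 j.isLt
    have hj0 : (0 : ℝ) ≤ (j : ℕ) := Nat.cast_nonneg _
    have habs : |(((round c + (j : ℕ) : ℤ) : ℝ) - c)| ≤ (m : ℝ) + 1 / 2 := by
      push_cast
      calc |((round c : ℤ) : ℝ) + (j : ℕ) - c| = |(((round c : ℤ) : ℝ) - c) + (j : ℕ)| := by ring_nf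
        _ ≤ |((round c : ℤ) : ℝ) - c| + |((j : ℕ) : ℝ)| := abs_add_le _ _
        _ ≤ 1 / 2 + m := add_le_add hrc (by rw [abs_of_nonneg hj0]; exact hj)
        _ = (m : ℝ) + 1 / 2 := add_comm _ _
    have hsq : (((round c + (j : ℕ) : ℤ) : ℝ) - c) ^ 2 ≤ ((m : ℝ) + 1 / 2) ^ 2 := by
      rw [← sq_abs]; exact pow_le_pow_left₀ (abs_nonneg _) habs 2
    nlinarith [mul_le_mul_of_nonneg_left hsq hθ']
  unfold GW
  calc ((m : ℝ) + 1) * Real.exp (-1) = ∑ _j : Fin (m + 1), Real.exp (-1) := by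
        rw [Finset.sum_const, Finset.card_univ, Fintype.card_fin, nsmul_eq_mul]; push_cast; ring
    _ ≤ ∑ j : Fin (m + 1), gfun θ c (window c w (ι j)) := Finset.sum_le_sum fun j _ => hpt j
    _ = ∑ o ∈ Finset.univ.image ι, gfun θ c (window c w o) := by rw [Finset.sum_image fun j _ j' _ h => hιinj h]
    _ ≤ ∑ o : Fin (2 ^ (w + 1)), gfun θ c (window c w o) :=
        Finset.sum_le_sum_of_subset_of_nonneg (Finset.subset_univ _) fun o _ _ => (gfun_pos θ c _).le

/-- `1/(1 - e^{-u}) ≤ 1 + 1/u` for `u > 0`. [folklore] -/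
theorem one_div_one_sub_exp_neg_le {u : ℝ} (hu : 0 < u) : 1 / (1 - Real.exp (-u)) ≤ 1 + 1 / u := by
  have h1 : Real.exp (-u) ≤ 1 / (1 + u) := by
    rw [Real.exp_neg, one_div]
    exact inv_anti₀ (by linarith) (by linarith [Real.add_one_le_exp u])
  have h2 : u / (1 + u) ≤ 1 - Real.exp (-u) := by
    have : 1 - 1 / (1 + u) = u / (1 + u) := by field_simp; ring
    linarith
  have h3 : 0 < u / (1 + u) := by positivity
  calc 1 / (1 - Real.exp (-u)) ≤ 1 / (u / (1 + u)) := one_div_le_one_div_of_le h3 h2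
    _ = 1 + 1 / u := by field_simp; ring

/-- **The Gaussian mass outside the window**: with `K = 2ʷ` and `0 < θ`,
`Z - G_W ≤ 2·e^{-θ(K - 1/2)²}·(1 + 1/(2θ(K - 1/2)))` — the points outside `round(c) + [-K, K)` are at
distance `≥ K - 1/2 + t` from `c` (`t = 0, 1, 2, …` on each side), and `e^{-θ(K-1/2+t)²} ≤ e^{-θ(K-1/2)²}·(e^{-2θ(K-1/2)})ᵗ`
sums geometrically. [cite: GentryPeikertVaikuntanathan2008, Lemma 4.2 (proof: the tail of `ρ_s` outside `c ± s·t(n)`)] -/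
theorem Zr_sub_GW_le {θ : ℚ} (hθ : 0 < θ) (c : ℚ) (w : ℕ) :
    Zr θ c - GW θ c w ≤
      2 * Real.exp (-((θ : ℝ) * ((2 : ℝ) ^ w - 1 / 2) ^ 2)) * (1 + 1 / (2 * (θ : ℝ) * ((2 : ℝ) ^ w - 1 / 2))) := by
  classical
  have hθ' : (0 : ℝ) < θ := by exact_mod_cast hθ
  set K : ℝ := (2 : ℝ) ^ w with hK
  have hK1 : 1 ≤ K := by rw [hK]; exact_mod_cast Nat.one_le_two_pow
  set Kz : ℤ := (2 : ℤ) ^ w with hKz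
  have hKzR : (Kz : ℝ) = K := by rw [hKz, hK]; push_cast; rfl
  set c₀ : ℤ := round c with hc₀
  set δ : ℝ := (c₀ : ℝ) - (c : ℝ) with hδ
  have hδabs : |δ| ≤ 1 / 2 := by
    have h := abs_sub_round (c : ℝ)
    rw [abs_sub_comm] at h
    have : ((round c : ℤ) : ℝ) = ((round (c : ℝ) : ℤ) : ℝ) := by rw [Rat.round_cast]
    rw [hδ, hc₀, this]; exact h
  obtain ⟨hδ1, hδ2⟩ := abs_le.1 hδabs
  set u : ℝ := 2 * (θ : ℝ) * (K - 1 / 2) with hu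
  have hu0 : 0 < u := by rw [hu]; nlinarith
  set ρ : ℝ := Real.exp (-u) with hρ
  have hρ0 : 0 ≤ ρ := (Real.exp_pos _).le
  have hρ1 : ρ < 1 := by rw [hρ, ← Real.exp_zero]; exact Real.exp_lt_exp.2 (by linarith)
  set C : ℝ := Real.exp (-((θ : ℝ) * (K - 1 / 2) ^ 2)) with hC
  have hC0 : 0 ≤ C := (Real.exp_pos _).le
  set W : Finset ℤ := Wset c w with hW
  set g : ℤ → ℝ := gfun θ c with hg
  -- `Z - G = ∑_{x ∉ W} g(x)`
  have hcompl : HasSum (fun x => if x ∈ W then 0 else g x) (Zr θ c - GW θ c w) := by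
    have h1 := hasSum_gfun hθ c
    have h2 : HasSum (fun x => if x ∈ W then g x else 0) (∑ x ∈ W, (if x ∈ W then g x else 0)) :=
      hasSum_sum_of_ne_finset_zero (fun x hx => if_neg hx)
    have hs : ∑ x ∈ W, (if x ∈ W then g x else 0) = GW θ c w := by
      rw [Finset.sum_ite_of_true (fun x hx => hx), hW, sum_Wset]; rfl
    rw [hs] at h2
    have h3 := h1.sub h2
    have hfun : (fun x => gfun θ c x - (if x ∈ W then g x else 0)) = fun x => if x ∈ W then 0 else g x := by
      funext x
      split_ifs <;> simp [hg]
    rw [hfun] at h3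
    exact h3
  -- the two geometric majorants
  set fp : ℤ → ℝ := fun x => if Kz ≤ x - c₀ then ρ ^ (x - c₀ - Kz).toNat else 0 with hfp
  set fm : ℤ → ℝ := fun x => if x - c₀ ≤ -Kz - 1 then ρ ^ (-(x - c₀) - Kz - 1).toNat else 0 with hfm
  have hgeo : HasSum (fun t : ℕ => ρ ^ t) (1 - ρ)⁻¹ := hasSum_geometric_of_lt_one hρ0 hρ1
  have hfp_sum : HasSum fp (1 - ρ)⁻¹ := by
    have hinj : Function.Injective fun t : ℕ => c₀ + Kz + t := fun t t' h => by
      simpa using h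
    rw [← hinj.hasSum_iff]
    · convert hgeo using 1
      funext t
      simp only [Function.comp_apply, hfp]
      rw [if_pos (by omega)]
      congr 1
      omega
    · intro x hx
      simp only [hfp]
      rw [if_neg]
      intro hle
      exact hx ⟨(x - c₀ - Kz).toNat, by push_cast; omega⟩
  have hfm_sum : HasSum fm (1 - ρ)⁻¹ := by
    have hinj : Function.Injective fun t : ℕ => c₀ - Kz - 1 - t := fun t t' h => by
      simpa using h
    rw [← hinj.hasSum_iff]
    · convert hgeo using 1
      funext t
      simp only [Function.comp_apply, hfm]
      rw [if_pos (by omega)]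
      congr 1
      omega
    · intro x hx
      simp only [hfm]
      rw [if_neg]
      intro hle
      exact hx ⟨(-(x - c₀) - Kz - 1).toNat, by push_cast; omega⟩
  have hmaj : HasSum (fun x => C * (fp x + fm x)) (C * ((1 - ρ)⁻¹ + (1 - ρ)⁻¹)) := (hfp_sum.add hfm_sum).mul_left C
  -- pointwise domination
  have hexp_le : ∀ t : ℕ, ∀ y : ℝ, K - 1 / 2 + t ≤ |y| → Real.exp (-((θ : ℝ) * y ^ 2)) ≤ C * ρ ^ t := by
    intro t y hy
    have ht0 : (0 : ℝ) ≤ t := Nat.cast_nonneg t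
    have hy0 : 0 ≤ K - 1 / 2 + t := by linarith
    have hsq : (K - 1 / 2) ^ 2 + 2 * (K - 1 / 2) * t ≤ y ^ 2 := by
      calc (K - 1 / 2) ^ 2 + 2 * (K - 1 / 2) * t ≤ (K - 1 / 2 + t) ^ 2 := by nlinarith
        _ ≤ |y| ^ 2 := pow_le_pow_left₀ hy0 hy 2
        _ = y ^ 2 := sq_abs y
    have hpow : C * ρ ^ t = Real.exp (-((θ : ℝ) * ((K - 1 / 2) ^ 2 + 2 * (K - 1 / 2) * t))) := by
      rw [hC, hρ, ← Real.exp_nat_mul, ← Real.exp_add, hu]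
      congr 1; ring
    rw [hpow]
    exact Real.exp_le_exp.2 (by nlinarith)
  have hpt : ∀ x, (if x ∈ W then 0 else g x) ≤ C * (fp x + fm x) := by
    intro x
    have hfp0 : 0 ≤ fp x := by simp only [hfp]; split_ifs <;> positivity
    have hfm0 : 0 ≤ fm x := by simp only [hfm]; split_ifs <;> positivity
    by_cases hx : x ∈ W
    · rw [if_pos hx]; positivity
    · rw [if_neg hx]
      have hout : ¬(-(2 : ℤ) ^ w ≤ x - round c ∧ x - round c < 2 ^ w) := by
        rw [← mem_range_window_iff, ← mem_Wset_iff]; exact hx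
      have hgx : g x = Real.exp (-((θ : ℝ) * (((x - c₀ : ℤ) : ℝ) + δ) ^ 2)) := by
        simp only [hg, gfun, hδ]; push_cast; ring_nf
      rcases not_and_or.1 hout with h1 | h1
      · -- left tail: `x - c₀ ≤ -K - 1`
        rw [not_le] at h1
        have hle : x - c₀ ≤ -Kz - 1 := by rw [hKz, hc₀]; omega
        set t : ℕ := (-(x - c₀) - Kz - 1).toNat with ht
        have htz : ((t : ℕ) : ℤ) = -(x - c₀) - Kz - 1 := by rw [ht]; omega
        have hbound : g x ≤ C * ρ ^ t := by
          rw [hgx]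
          refine hexp_le t _ ?_
          have hxr : (((x - c₀ : ℤ)) : ℝ) = -(K + 1 + t) := by
            have : (x - c₀ : ℤ) = -(Kz + 1 + t) := by omega
            rw [this]; push_cast; rw [hKzR]
          rw [hxr, abs_of_nonpos (by linarith)]
          linarith
        have : fm x = ρ ^ t := by simp only [hfm, if_pos hle, ht]
        rw [this]
        nlinarith [mul_nonneg hC0 hfp0]
      · -- right tail: `K ≤ x - c₀`
        rw [not_lt] at h1
        have hle : Kz ≤ x - c₀ := by rw [hKz, hc₀]; exact h1
        set t : ℕ := (x - c₀ - Kz).toNat with ht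
        have htz : ((t : ℕ) : ℤ) = x - c₀ - Kz := by rw [ht]; omega
        have hbound : g x ≤ C * ρ ^ t := by
          rw [hgx]
          refine hexp_le t _ ?_
          have hxr : (((x - c₀ : ℤ)) : ℝ) = K + t := by
            have : (x - c₀ : ℤ) = Kz + t := by omega
            rw [this]; push_cast; rw [hKzR]
          rw [hxr, abs_of_nonneg (by linarith)]
          linarith
        have : fp x = ρ ^ t := by simp only [hfp, if_pos hle, ht]
        rw [this]
        nlinarith [mul_nonneg hC0 hfm0]
  have hle := hasSum_le hpt hcompl hmaj
  refine hle.trans ?_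
  have hinv : (1 - ρ)⁻¹ ≤ 1 + 1 / u := by rw [← one_div]; exact one_div_one_sub_exp_neg_le hu0
  have := mul_le_mul_of_nonneg_left hinv hC0
  linarith

/-- **The sampler's accuracy from its parameters.** For `0 < θ ≤ 1`, `N ≥ 1`, a window exponent `w` and a
Taylor scale `s` with `θ(2ʷ + 1/2)² ≤ 2ˢ`, and an auxiliary `m` with `θ(m + 1/2)² ≤ 1`, `m + 1 ≤ 2ʷ` (the
`m + 1` points `round c, …, round c + m` of weight `≥ e⁻¹` in the window), writing
`η₀ = 2^{s+1}/N! + 2⁻ᴾ ≤ 1/2` for the accuracy of the acceptance probabilities: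

  `Δ(rejLaw R, D_{ℤ,√(π/θ),c}) ≤ (1 - ((m+1)e⁻¹/2^{w+1} - η₀))ᴿ + e·2^{w+1}η₀/(m+1)
      + e·2e^{-θ(2ʷ-1/2)²}(1 + 1/(2θ(2ʷ-1/2)))`.

A consumer makes all three terms small by taking `2ʷ ≈ 2·max(m+1, √(L/θ))`, `R ≈ 2^{w+1}L/(m+1)`,
`P, N - s ≥ w + L`. [cite: GentryPeikertVaikuntanathan2008, Lemma 4.2] -/
theorem tvDist_rejLaw_le_of_params {θ : ℚ} (hθ : 0 < θ) (hθ1 : θ ≤ 1) (c : ℚ) {s N : ℕ} (P w R : ℕ) {m : ℕ}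
    (hN : 1 ≤ N) (hs : (θ : ℝ) * (2 ^ w + 1 / 2) ^ 2 ≤ 2 ^ s) (hm : (θ : ℝ) * ((m : ℝ) + 1 / 2) ^ 2 ≤ 1)
    (hmw : m + 1 ≤ 2 ^ w) (hη : (2 : ℝ) ^ (s + 1) / N.factorial + 1 / 2 ^ P ≤ 1 / 2) :
    (rejLaw θ c s N P w R).tvDist (Literature.Algebra.EuclideanLattices.discreteGaussianInt (Real.sqrt (π / θ)) c) ≤
      (1 - (((m : ℝ) + 1) * Real.exp (-1) / 2 ^ (w + 1) - ((2 : ℝ) ^ (s + 1) / N.factorial + 1 / 2 ^ P))) ^ R +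
        Real.exp 1 * 2 ^ (w + 1) * ((2 : ℝ) ^ (s + 1) / N.factorial + 1 / 2 ^ P) / ((m : ℝ) + 1) +
        Real.exp 1 * (2 * Real.exp (-((θ : ℝ) * ((2 : ℝ) ^ w - 1 / 2) ^ 2)) *
          (1 + 1 / (2 * (θ : ℝ) * ((2 : ℝ) ^ w - 1 / 2)))) := by
  set η₀ : ℝ := (2 : ℝ) ^ (s + 1) / N.factorial + 1 / 2 ^ P with hη₀
  have hη₀0 : 0 ≤ η₀ := by rw [hη₀]; positivity
  have hacc : ∀ o : Fin (2 ^ (w + 1)),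
      |(accNum θ c s N P (window c w o) : ℝ) / 2 ^ P - gfun θ c (window c w o)| ≤ η₀ :=
    fun o => abs_accNum_window_sub_le hθ.le c P w hs hN o
  have hpos := accTot_pos hθ.le hθ1 c s N P w hη hacc
  have hmain := tvDist_rejLaw_discreteGaussianInt_le hθ c s N P w hacc hpos R
  refine hmain.trans ?_
  -- the three quantities
  obtain ⟨hA0, hA1⟩ := accProb_mem θ c s N P w
  have hA := accProb_ge θ c s N P w hacc
  have hG := GW_ge hθ.le c w m hm hmw
  have hG0 := GW_pos θ c w
  have hZG := GW_le_Zr hθ c w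
  have hZ0 := Zr_pos hθ c
  have htail := Zr_sub_GW_le hθ c w
  have he : Real.exp (-1) * Real.exp 1 = 1 := by rw [← Real.exp_add]; norm_num
  have he0 : 0 < Real.exp (-1) := Real.exp_pos _
  have hm1 : (0 : ℝ) < (m : ℝ) + 1 := by positivity
  have h2w : (0 : ℝ) < 2 ^ (w + 1) := by positivity
  -- term 1
  have h1 : (1 - accProb θ c s N P w) ^ R ≤ (1 - (((m : ℝ) + 1) * Real.exp (-1) / 2 ^ (w + 1) - η₀)) ^ R := by
    refine pow_le_pow_left₀ (by linarith) ?_ R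
    have : ((m : ℝ) + 1) * Real.exp (-1) / 2 ^ (w + 1) ≤ GW θ c w / 2 ^ (w + 1) :=
      div_le_div_of_nonneg_right hG h2w.le
    linarith
  -- term 2: `1/G ≤ e/(m+1)`
  have hGinv : 1 / GW θ c w ≤ Real.exp 1 / ((m : ℝ) + 1) := by
    rw [div_le_div_iff₀ hG0 hm1, one_mul]
    nlinarith
  have h2 : 2 ^ (w + 1) * η₀ / GW θ c w ≤ Real.exp 1 * 2 ^ (w + 1) * η₀ / ((m : ℝ) + 1) := by
    have hnum : 0 ≤ (2 : ℝ) ^ (w + 1) * η₀ := by positivity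
    calc 2 ^ (w + 1) * η₀ / GW θ c w = 2 ^ (w + 1) * η₀ * (1 / GW θ c w) := by ring
      _ ≤ 2 ^ (w + 1) * η₀ * (Real.exp 1 / ((m : ℝ) + 1)) := mul_le_mul_of_nonneg_left hGinv hnum
      _ = Real.exp 1 * 2 ^ (w + 1) * η₀ / ((m : ℝ) + 1) := by ring
  -- term 3: `1/Z ≤ e`
  have hZinv : 1 / Zr θ c ≤ Real.exp 1 := by
    rw [div_le_iff₀ hZ0]
    have hG1 : Real.exp (-1) ≤ GW θ c w := by
      have : (1 : ℝ) * Real.exp (-1) ≤ ((m : ℝ) + 1) * Real.exp (-1) := by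
        refine mul_le_mul_of_nonneg_right ?_ he0.le
        have : (0 : ℝ) ≤ m := Nat.cast_nonneg m
        linarith
      linarith
    nlinarith
  have h3 : (Zr θ c - GW θ c w) / Zr θ c ≤ Real.exp 1 * (2 * Real.exp (-((θ : ℝ) * ((2 : ℝ) ^ w - 1 / 2) ^ 2)) *
      (1 + 1 / (2 * (θ : ℝ) * ((2 : ℝ) ^ w - 1 / 2)))) := by
    have hd0 : 0 ≤ Zr θ c - GW θ c w := by linarith
    calc (Zr θ c - GW θ c w) / Zr θ c = (Zr θ c - GW θ c w) * (1 / Zr θ c) := by ring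
      _ ≤ (2 * Real.exp (-((θ : ℝ) * ((2 : ℝ) ^ w - 1 / 2) ^ 2)) * (1 + 1 / (2 * (θ : ℝ) * ((2 : ℝ) ^ w - 1 / 2)))) *
          Real.exp 1 := mul_le_mul htail hZinv (by positivity) (hd0.trans htail)
      _ = _ := by ring
  linarith

end Sampler

end GaussRej

end Literature.Probability.Distributions

end
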